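import Summits.AnomalousDissipation.AnomalousDissipation.Theorems.SawtoothPulseCascadeK1LocalisedCascadePhaseTHOsc
import Summits.AnomalousDissipation.AnomalousDissipation.Theorems.SawtoothPulseCascadeK1LocalisedCascadePhaseOVOsc
import Summits.AnomalousDissipation.AnomalousDissipation.Theorems.SawtoothPulseCascadeK1LocalisedCascadePhaseCHOsc
import Summits.AnomalousDissipation.AnomalousDissipation.Theorems.SawtoothPulseCascadeK1LocalisedCascadeLedgerFeedChain

/-!
# K1loc — ONE RESOLVED PHASE OF THE FIBRE LEDGER AT AN ARBITRARY WINDOW, OSCILLATORY GRADE (composition)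

Prover lane on the crux `K1LocalisedCascade` (stmt-AnomalousDissipation-19491), route `SawtoothPulseCascade`
(S-B/S-C assembly seat; the LEDGER ASSEMBLY, composition layer, Osc grade).  `…LedgerFeedChain.strip_offCone_resolved_step`
instantiated with the five oscillatory numeric steps at an arbitrary window `K ≥ 6` (next window `25K`):
(T-H) `…PhaseTHOsc.lowFibre_hstep_osc_le`, (S-V) `…PhaseSVOsc.strip_vstep_osc_le`, (O-V) `…PhaseOVOsc.offCone_vstep_osc_le`,
(C-H) `…PhaseCHOsc.subcone_hstep_osc_le` (the same feed class `C_j` serves S-V and O-V), with the shell amplitude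
`√A_j(3K+1) ≤ 𝔞` and the off-cone amplitude `√O_j(K) ≤ o` supplied by the caller (`…ShellChainOsc`, `…LedgerFeedChain.sqrt_offCone_next_le`):
  `S_{j+1}(25K) + O_{j+1}(25K) ≤ S_j(K) + O_j(K) + e_j(K)`,
  `e_j(K) = J_T + 2√J_T·o + (√J_S + √J_C + 𝔞 + √f_C)² + (√J_O + √J_C + 𝔞 + √f_C)² + f_S + f_T + f_O`
with the explicit `J`'s and far terms `f` of those files.  This is the per-phase increment of the resolved ledger
(`…LedgerFeedChain.k1Localised_of_resolved_ledger`).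
No definitions; no statement about the crux. [cite: Grafakos2014, Prop. 3.1.2 (5), Prop. 3.2.7 (3), §3.1.3] [problem: turb]
-/

-- `Summit.<Summit>.<Problem>`: single-conjunct summit, the duplicate namespace segment is deliberate.
set_option linter.dupNamespace false

noncomputable section

namespace Summit.AnomalousDissipation.AnomalousDissipation.Theorems.SawtoothPulseCascade.K1Window

open MeasureTheory Set Filter Topology UnitAddTorus Function Complex Metric
open scoped Real ENNReal
open Literature.Analysis Literature.Analysis.FunctionSpaces Literature.Analysis.FunctionSpaces.Torus Literature.Analysis.FluidPDE
open Literature.Analysis.FluidPDE.ShearStage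
open Literature.Analysis.FluidPDE.SawtoothCascade Literature.Analysis.FluidPDE.SawtoothCascade.CascadeParams
open Summit.AnomalousDissipation.AnomalousDissipation.Theorems.SawtoothPulseCascade.K1Start
open Summit.AnomalousDissipation.AnomalousDissipation.Theorems.SawtoothPulseCascade.K1Flat
open Summit.AnomalousDissipation.AnomalousDissipation.Theorems.SawtoothPulseCascade.K1Ledger.From

section Cascade

variable (P : CascadeParams)

set_option maxHeartbeats 400000 in
/-- **ONE RESOLVED PHASE AT WINDOW `K ≥ 6`, OSCILLATORY GRADE** (see the file header):
`S_{j+1}(25K) + O_{j+1}(25K) ≤ S_j(K) + O_j(K) + e_j(K)`. [cite: Grafakos2014, Prop. 3.1.2 (5), Prop. 3.2.7 (3), §3.1.3] -/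
theorem resolved_step_osc (hγ : P.γ = 8) (hδ₀ : 0 < P.δ₀) (hd : P.d = 2) (hN₀ : P.N₀ = 1) (hρN : P.ρN = 2)
    (a b : ℕ → UnitAddTorus (Fin 2) → ℝ) (has : ∀ j, IsSmooth (a j)) (h0 : a 0 = datum)
    (hb : ∀ j, b j = a j ∘ shearMap 0 1 (amp ⟨P.U j, P.U_periodic j, P.contDiff_U (P.δ_pos hδ₀ (by rw [hd]; norm_num) j)⟩ P.γ))
    (hab : ∀ j, a (j + 1) = b j ∘ shearMap 1 0 (amp ⟨P.U j, P.U_periodic j, P.contDiff_U (P.δ_pos hδ₀ (by rw [hd]; norm_num) j)⟩ P.γ))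
    {K : ℕ} (hK : 6 ≤ K) {ε : ℝ} (hε : 0 < ε) (j : ℕ)
    (hMδT : max 1 (Real.sqrt (2 * Real.log (1 / (ε / (15 * π * 8 * 4096 * (K : ℝ)) * (1 / 64) ^ j)))) * P.δ j < π / 2)
    (hMδS : max 1 (Real.sqrt (2 * Real.log (1 / (ε / (15 * π * 8 * 2 ^ 19 * ((5 * K : ℕ) : ℝ)) * (1 / 64) ^ j)))) * P.δ j < π / 2)
    (hMδO : max 1 (Real.sqrt (2 * Real.log (1 / (ε / (7 * π * 8 * 2 ^ 19 * ((6 * K : ℕ) : ℝ)) * (1 / 64) ^ j)))) * P.δ j < π / 2)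
    (hMδC : max 1 (Real.sqrt (2 * Real.log (1 / (ε / (7 * π * 8 * 2 ^ 19 * ((3 * K + 1 : ℕ) : ℝ)) * (1 / 64) ^ j)))) * P.δ j < π / 2)
    {𝔞 o : ℝ}
    (h𝔞 : Real.sqrt (∑' k : Fin 2 → ℤ, (if ((3 * K + 1 : ℕ) : ℤ) ≤ |k 0| ∧ ((1 : ℕ) : ℤ) * |k 0| ≤ ((2 : ℕ) : ℤ) * |k 1|
            then (1 : ℝ) else 0) * ‖mFourierCoeff (fun x => (a j x : ℂ)) k‖ ^ 2) ≤ 𝔞)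
    (ho : Real.sqrt (∑' k : Fin 2 → ℤ, (if (K : ℤ) ≤ |k 0| ∧ ((1 : ℕ) : ℤ) * |k 0| ≤ ((4 : ℕ) : ℤ) * |k 1| then (1 : ℝ) else 0) * ‖mFourierCoeff (fun x => (a j x : ℂ)) k‖ ^ 2) ≤ o) :
    ∑' k : Fin 2 → ℤ, (if |k 0| < ((25 * K : ℕ) : ℤ) then (1 : ℝ) else 0) * ‖mFourierCoeff (fun x => (a (j + 1) x : ℂ)) k‖ ^ 2 +
      ∑' k : Fin 2 → ℤ, (if ((25 * K : ℕ) : ℤ) ≤ |k 0| ∧ ((1 : ℕ) : ℤ) * |k 0| ≤ ((4 : ℕ) : ℤ) * |k 1| then (1 : ℝ) else 0) *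
        ‖mFourierCoeff (fun x => (a (j + 1) x : ℂ)) k‖ ^ 2 ≤
      ∑' k : Fin 2 → ℤ, (if |k 0| < (K : ℤ) then (1 : ℝ) else 0) * ‖mFourierCoeff (fun x => (a j x : ℂ)) k‖ ^ 2 +
      ∑' k : Fin 2 → ℤ, (if (K : ℤ) ≤ |k 0| ∧ ((1 : ℕ) : ℤ) * |k 0| ≤ ((4 : ℕ) : ℤ) * |k 1| then (1 : ℝ) else 0) * ‖mFourierCoeff (fun x => (a j x : ℂ)) k‖ ^ 2 +
      (Real.sqrt (3 * 2 ^ 2 *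
            (4 / 3 * ε ^ 2 + 4 / 3 * (2 * 2 ^ j / (π * (K : ℝ))) ^ 2 + 8 * 2 ^ j * 15 / (π * (K : ℝ)) +
              ((7 * j + 12 : ℕ) : ℝ) * (8 * 2 ^ j * 15 ^ 2 *
                Real.sqrt (4 * (max 1 (Real.sqrt (2 * Real.log (1 / (ε / (15 * π * 8 * 4096 * (K : ℝ)) * (1 / 64) ^ j)))) * P.δ j) / (π * (K : ℝ))) +
                8 * 15 ^ 2 * (max 1 (Real.sqrt (2 * Real.log (1 / (ε / (15 * π * 8 * 4096 * (K : ℝ)) * (1 / 64) ^ j)))) * P.δ j) / π))) ^ 2 +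
        2 * Real.sqrt (3 * 2 ^ 2 *
            (4 / 3 * ε ^ 2 + 4 / 3 * (2 * 2 ^ j / (π * (K : ℝ))) ^ 2 + 8 * 2 ^ j * 15 / (π * (K : ℝ)) +
              ((7 * j + 12 : ℕ) : ℝ) * (8 * 2 ^ j * 15 ^ 2 *
                Real.sqrt (4 * (max 1 (Real.sqrt (2 * Real.log (1 / (ε / (15 * π * 8 * 4096 * (K : ℝ)) * (1 / 64) ^ j)))) * P.δ j) / (π * (K : ℝ))) +
                8 * 15 ^ 2 * (max 1 (Real.sqrt (2 * Real.log (1 / (ε / (15 * π * 8 * 4096 * (K : ℝ)) * (1 / 64) ^ j)))) * P.δ j) / π))) * o +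
        (Real.sqrt (3 * (81 / 39) ^ 2 *
            (4 / 3 * ε ^ 2 + 4 / 3 * (2 * 2 ^ j / (π * (5 * (K : ℝ)))) ^ 2 + 8 * 2 ^ j * 15 / (π * (5 * (K : ℝ))) +
              ((7 * j + 19 : ℕ) : ℝ) * (8 * 2 ^ j * 15 ^ 2 *
                Real.sqrt (4 * (max 1 (Real.sqrt (2 * Real.log (1 / (ε / (15 * π * 8 * 2 ^ 19 * ((5 * K : ℕ) : ℝ)) * (1 / 64) ^ j)))) * P.δ j) / (π * (5 * (K : ℝ)))) +
                8 * 15 ^ 2 * (max 1 (Real.sqrt (2 * Real.log (1 / (ε / (15 * π * 8 * 2 ^ 19 * ((5 * K : ℕ) : ℝ)) * (1 / 64) ^ j)))) * P.δ j) / π))) +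
          Real.sqrt (3 * (77 / 37) ^ 2 *
            (4 / 3 * ε ^ 2 + 4 / 3 * (2 * 2 ^ j / (π * (2 * ((3 * K + 1 : ℕ) : ℝ)))) ^ 2 + 8 * 2 ^ j * 7 / (π * (2 * ((3 * K + 1 : ℕ) : ℝ))) +
              ((7 * j + 19 : ℕ) : ℝ) * (8 * 2 ^ j * 7 ^ 2 *
                Real.sqrt (4 * (max 1 (Real.sqrt (2 * Real.log (1 / (ε / (7 * π * 8 * 2 ^ 19 * ((3 * K + 1 : ℕ) : ℝ)) * (1 / 64) ^ j)))) * P.δ j) / (π * (2 * ((3 * K + 1 : ℕ) : ℝ)))) +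
                8 * 7 ^ 2 * (max 1 (Real.sqrt (2 * Real.log (1 / (ε / (7 * π * 8 * 2 ^ 19 * ((3 * K + 1 : ℕ) : ℝ)) * (1 / 64) ^ j)))) * P.δ j) / π))) + 𝔞 + Real.sqrt (((1 + P.γ) ^ (2 * j) / (((3 * K + 1) * 2 ^ (7 * j + 19) : ℕ) : ℝ)) ^ 2)) ^ 2 +
        (Real.sqrt (3 * (81 / 39) ^ 2 *
            (4 / 3 * ε ^ 2 + 4 / 3 * (2 * 2 ^ j / (π * (12 * (K : ℝ)))) ^ 2 + 8 * 2 ^ j * 7 / (π * (12 * (K : ℝ))) +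
              ((7 * j + 19 : ℕ) : ℝ) * (8 * 2 ^ j * 7 ^ 2 *
                Real.sqrt (4 * (max 1 (Real.sqrt (2 * Real.log (1 / (ε / (7 * π * 8 * 2 ^ 19 * ((6 * K : ℕ) : ℝ)) * (1 / 64) ^ j)))) * P.δ j) / (π * (12 * (K : ℝ)))) +
                8 * 7 ^ 2 * (max 1 (Real.sqrt (2 * Real.log (1 / (ε / (7 * π * 8 * 2 ^ 19 * ((6 * K : ℕ) : ℝ)) * (1 / 64) ^ j)))) * P.δ j) / π))) +
          Real.sqrt (3 * (77 / 37) ^ 2 *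
            (4 / 3 * ε ^ 2 + 4 / 3 * (2 * 2 ^ j / (π * (2 * ((3 * K + 1 : ℕ) : ℝ)))) ^ 2 + 8 * 2 ^ j * 7 / (π * (2 * ((3 * K + 1 : ℕ) : ℝ))) +
              ((7 * j + 19 : ℕ) : ℝ) * (8 * 2 ^ j * 7 ^ 2 *
                Real.sqrt (4 * (max 1 (Real.sqrt (2 * Real.log (1 / (ε / (7 * π * 8 * 2 ^ 19 * ((3 * K + 1 : ℕ) : ℝ)) * (1 / 64) ^ j)))) * P.δ j) / (π * (2 * ((3 * K + 1 : ℕ) : ℝ)))) +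
                8 * 7 ^ 2 * (max 1 (Real.sqrt (2 * Real.log (1 / (ε / (7 * π * 8 * 2 ^ 19 * ((3 * K + 1 : ℕ) : ℝ)) * (1 / 64) ^ j)))) * P.δ j) / π))) + 𝔞 + Real.sqrt (((1 + P.γ) ^ (2 * j) / (((3 * K + 1) * 2 ^ (7 * j + 19) : ℕ) : ℝ)) ^ 2)) ^ 2 +
        ((1 + P.γ) ^ (2 * (j + 1)) / (((5 * K) * 2 ^ (7 * j + 19) : ℕ) : ℝ)) ^ 2 +
        ((1 + P.γ) ^ (2 * j) / ((K * 2 ^ (7 * j + 12) : ℕ) : ℝ)) ^ 2 +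
        ((1 + P.γ) ^ (2 * (j + 1)) / (((6 * K) * 2 ^ (7 * j + 19) : ℕ) : ℝ)) ^ 2) := by
  have h1 := strip_vstep_osc_le P hγ hδ₀ hd hN₀ hρN a b has h0 hb hab hK hε j hMδS
  have h2 := lowFibre_hstep_osc_le P hγ hδ₀ hd hN₀ hρN a b has h0 hb hab hK hε j hMδT
  have h3 := offCone_vstep_osc_le P hγ hδ₀ hd hN₀ hρN a b has h0 hb hab hK hε j hMδO
  have h4 := subcone_hstep_osc_le P hγ hδ₀ hd hN₀ hρN a b has h0 hb hab hK hε j hMδC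
  have hI0 : ∀ (q : (Fin 2 → ℤ) → Prop) [DecidablePred q] (v : UnitAddTorus (Fin 2) → ℝ),
      0 ≤ ∑' k : Fin 2 → ℤ, (if q k then (1 : ℝ) else 0) * ‖mFourierCoeff (fun x => (v x : ℂ)) k‖ ^ 2 :=
    fun q _ v => tsum_nonneg fun k => mul_nonneg (by split_ifs <;> norm_num) (sq_nonneg _)
  have h1' := h1.trans (add_assoc _ _ _).symm.le
  have h2' := h2.trans (add_assoc _ _ _).symm.le
  exact strip_offCone_resolved_step h1' h2' h3 h4 h4 h𝔞 h𝔞 ho (hI0 _ _) (hI0 _ _) (hI0 _ _) (Real.sqrt_nonneg _)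
    (Real.sqrt_nonneg _) (Real.sqrt_nonneg _) (Real.sqrt_nonneg _) (Real.sqrt_nonneg _) (sq_nonneg _) (sq_nonneg _)

end Cascade

end Summit.AnomalousDissipation.AnomalousDissipation.Theorems.SawtoothPulseCascade.K1Window
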